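import Literature.NumberTheory.Automorphic.CuspFormsBoundedHC
import Literature.NumberTheory.Automorphic.AutomorphicFormsStableCenter
import Literature.NumberTheory.Automorphic.AutomorphicRepDataSplitCenter
import Literature.NumberTheory.Automorphic.AutomorphicTwistNorm
import Literature.NumberTheory.Automorphic.IdeleNormDetGL
import Literature.NumberTheory.Automorphic.IdelicDyadicUnfolding
import Literature.NumberTheory.Automorphic.SiegelConeDyadic
import Mathlib.LinearAlgebra.Eigenspace.Triangularizable
import HarnessLib

/-!
# Cusp forms on `GL_n(𝔸_K)` with a central character of absolute value one are bounded:
# discharge of `cuspForm_bounded` (Borel–Jacquet 1979, 4.4 and 5.7)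

Topic `NumberTheory/Automorphic`; sibling proof file of `LangAutomorphicForms`, discharging its named
fact `cuspForm_bounded hcpt`: a cusp form `φ` on `GL_n(𝔸_K)` whose modulus is invariant under the
centre `Z(𝔸_K)` is bounded. Harish-Chandra's theorem for cusp forms INVARIANT under the split
component `A_G` is `IsCuspFormGL.bounded_of_center'` (`CuspFormsBoundedHC`, proved by the `L²`
compactness route). This file performs the classical reduction of an arbitrary (unitary) central
character to the `A_G`-invariant case (Borel–Jacquet 1979, 5.7: "`π = π₀ ⊗ |det|^s`"; Moeglin–
Waldspurger 1995, I.3.2: finiteness over the polynomial-exponential functions on `A_G`), for ONE cusp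
form rather than an irreducible representation:

* **E1** `norm_iterate_lieDeriv_one_apply_mul_le` — along the one-parameter group `e^t = exp(t·1)`
  of the central element `1 ∈ 𝔤𝔩_n(K_∞)` (`posRealScalar_eq_ofArch_expMem`), the slices of the
  central derivatives `1ᵏ φ` are bounded, `|(1ᵏ φ)(g e^t)| ≤ M_k |φ(g)|`: the ODE step of
  Harish-Chandra's finiteness theorem (`exists_submodule_oneParam_mem_of_isZFinite`,
  `exists_norm_deriv_le_of_finiteDimensional` of `AutomorphicFormsStableCenter`) and induction on `k`.
  Hence the `1ᵏ φ` have moderate growth and are cusp forms (`IsCuspFormGL.iterate_lieDeriv_one`).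
* **E2** Lemma A `re_eq_zero_of_lieDeriv_one_eq_smul`: an eigenfunction `1 ψ = μ ψ ≠ 0` with
  bounded slices has `Re μ = 0`; Lemma B `lieDeriv_one_sub_smul_eq_zero`: for `Re μ = 0` there are
  no Jordan blocks (`|ψ₁(g e^t)| = |ψ₁(g) + t ψ(g)|` would be unbounded).
* **E3** `IsCuspFormGL.bounded_of_norm_center'` (`n ≥ 1`): on the finite-dimensional span of the
  `1ᵏ φ` decompose `φ = ∑ φ_μ` into generalised eigenvectors of `1`
  (`Module.End.iSup_maxGenEigenspace_eq_top`); by E2 each `φ_μ ≠ 0` satisfies `φ_μ(a g) = a^μ φ_μ(g)`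
  on `A_G` with `Re μ = 0`; the twist `|det|^{-μ/n[K:ℚ]} φ_μ` (`AutomorphicTwistNorm`) is an
  `A_G`-invariant cusp form, bounded by `IsCuspFormGL.bounded_of_center'`, and has the same modulus
  as `φ_μ`.
* **`cuspForm_bounded_holds : cuspForm_bounded hcpt`** (`n = 0`: trivial group; `n ≥ 1`:
  `A_G ≤ Z(𝔸_K)`).

Everything is proved; the private `oneLie`, `eA`, `dSpan` are abbreviations local to the proof.

## References

* A. Borel, H. Jacquet, *Automorphic forms and automorphic representations*, Proc. Sympos. Pure
  Math. 33.1 (1979), 4.3, 4.4, 5.7 [BorelJacquet1979].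
* C. Moeglin, J.-L. Waldspurger, *Spectral decomposition and Eisenstein series* (1995), I.2.18,
  I.3.2 [MoeglinWaldspurger1995].
* A. Borel, *Automorphic forms on `SL₂(ℝ)`*, Cambridge Tracts in Math. 130 (1997), 8.6 [Borel1997].
-/

noncomputable section

-- Mathlib idiom (Mathlib/Algebra/Lie/OfAssociative.lean); needed to mention Lie subalgebras of matrix algebras
attribute [local instance 100] LieRing.ofAssociativeRing

open scoped MatrixGroups Matrix ContDiff Topology Classical NNReal
open Filter Set NumberField NumberField.mixedEmbedding IsDedekindDomain
open Polynomial

namespace Literature.NumberTheory.Automorphic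

-- `M_n(K ⊗ ℝ)` is finite-dimensional over `ℝ` (the tree's instance, as in `HarishChandraDiracGL`)
attribute [local instance] finiteDimensional_matrix_mixedSpace

variable {n : ℕ} {K : Type} [Field K] [NumberField K]

/-! ## Part E. Cusp forms whose modulus is invariant under `A_G` are bounded
(from `A_G`-invariance to an arbitrary central character): discharge of `cuspForm_bounded` -/

section CenterODE

variable {hcpt : isCompact_glFiniteIntegralLevel n K}

-- the scoped operator norm on `𝔤𝔩_n(K_∞)`, through which `IsArchSmooth` is defined
open scoped Matrix.Norms.Operator

/-- The central element `1 ∈ 𝔤𝔩_n(K_∞)` (private abbreviation). [folklore] -/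
private abbrev oneLie (hcpt : isCompact_glFiniteIntegralLevel n K) : (AutomorphyDatum.gl n K hcpt).arch.lie :=
  ⟨1, trivial⟩

/-- The one-parameter subgroup `e^t ∈ A_G ⊂ GL_n(𝔸_K)` of `1 ∈ 𝔤` (private abbreviation). [folklore] -/
private abbrev eA (hcpt : isCompact_glFiniteIntegralLevel n K) (t : ℝ) : (AdelicGroupData.gl n K).Adelic :=
  (AutomorphyDatum.gl n K hcpt).ofArch ((AutomorphyDatum.gl n K hcpt).arch.expMem (t • oneLie hcpt))

/-- `exp (t · 1) = z(e^t)`, the positive real scalar (`posRealScalar_eq_ofArch_expMem`). [folklore] -/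
private theorem eA_eq_posRealScalar (t : ℝ) : eA hcpt t = posRealScalar n K (expUnitNNReal t) := by
  rw [posRealScalar_eq_ofArch_expMem (hcpt := hcpt) (expUnitNNReal t), coe_expUnitNNReal, Real.log_exp]

/-- `z(τ) = exp ((log τ) · 1)`. [folklore] -/
private theorem posRealScalar_eq_eA (τ : ℝ≥0ˣ) :
    posRealScalar n K τ = eA hcpt (Real.log ((τ : ℝ≥0) : ℝ)) := by
  rw [eA_eq_posRealScalar, expUnitNNReal_log]

/-- `exp (t · 1) ∈ A_G`. [folklore] -/
private theorem eA_mem_center' (t : ℝ) : eA hcpt t ∈ (AdelicGroupData.gl n K).center' := by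
  rw [eA_eq_posRealScalar]
  exact ⟨_, rfl⟩

/-- `exp (t · 1)` is central. [folklore] -/
private theorem eA_mul_comm (t : ℝ) (g : (AdelicGroupData.gl n K).Adelic) : eA hcpt t * g = g * eA hcpt t :=
  Subgroup.mem_center_iff.1 ((AdelicGroupData.gl n K).center'_le (eA_mem_center' t)) g |>.symm

/-- `exp ((s + t) · 1) = exp (s · 1) exp (t · 1)`. [folklore] -/
private theorem eA_add (s t : ℝ) : eA hcpt (s + t) = eA hcpt s * eA hcpt t := by
  change (AutomorphyDatum.gl n K hcpt).ofArch _ = _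
  rw [RealMatrixGroup.expMem_add_smul, map_mul]

/-- `exp (0 · 1) = 1`. [folklore] -/
private theorem eA_zero : eA hcpt 0 = 1 := by
  change (AutomorphyDatum.gl n K hcpt).ofArch _ = _
  rw [RealMatrixGroup.expMem_zero_smul, map_one]

/-- Iterated central derivatives are smooth and `Z(𝔤)`-finite. [folklore] -/
private theorem isArchSmooth_isZFinite_iterate {φ : (AdelicGroupData.gl n K).Adelic → ℂ}
    (hφs : IsArchSmooth (AutomorphyDatum.gl n K hcpt).ofArch φ)
    (hφZ : IsZFinite (AutomorphyDatum.gl n K hcpt).ofArch φ) :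
    ∀ k : ℕ, IsArchSmooth (AutomorphyDatum.gl n K hcpt).ofArch
        ((lieDeriv (AutomorphyDatum.gl n K hcpt).ofArch (oneLie hcpt))^[k] φ) ∧
      IsZFinite (AutomorphyDatum.gl n K hcpt).ofArch
        ((lieDeriv (AutomorphyDatum.gl n K hcpt).ofArch (oneLie hcpt))^[k] φ)
  | 0 => ⟨hφs, hφZ⟩
  | k + 1 => by
    obtain ⟨h1, h2⟩ := isArchSmooth_isZFinite_iterate hφs hφZ k
    rw [Function.iterate_succ_apply']
    exact ⟨h1.lieDeriv_gl _, isZFinite_lieDeriv_gl h1 h2 _⟩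

/-- **Slices of the central derivatives along `A_G` are bounded** (the ODE step of Harish-Chandra's
finiteness theorem along the split component, Borel 1997, 8.6, with the bound of
`exists_norm_deriv_le_of_finiteDimensional`): if `|φ|` is `A_G`-invariant, `φ` smooth and
`Z(𝔤)`-finite, then `|(1ᵏ φ)(g e^t)| ≤ M_k |φ(g)|` for all `g`, `t`. Induction on `k`: all slices
`s ↦ (1ᵏ φ)(g e^{t+s})` lie in one finite-dimensional space of smooth functions, on which
`|u'(0)| ≤ C sup_{[-1,1]} |u|`. [cite: Borel1997, 8.6] -/
theorem norm_iterate_lieDeriv_one_apply_mul_le {φ : (AdelicGroupData.gl n K).Adelic → ℂ}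
    (hφs : IsArchSmooth (AutomorphyDatum.gl n K hcpt).ofArch φ)
    (hφZ : IsZFinite (AutomorphyDatum.gl n K hcpt).ofArch φ)
    (hA : ∀ a ∈ (AdelicGroupData.gl n K).center', ∀ g, ‖φ (a * g)‖ = ‖φ g‖) (k : ℕ) :
    ∃ M : ℝ, ∀ (g : (AdelicGroupData.gl n K).Adelic) (t : ℝ),
      ‖((lieDeriv (AutomorphyDatum.gl n K hcpt).ofArch (oneLie hcpt))^[k] φ) (g * eA hcpt t)‖ ≤ M * ‖φ g‖ := by
  induction k with
  | zero =>
    refine ⟨1, fun g t => ?_⟩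
    rw [Function.iterate_zero, id_eq, one_mul, ← eA_mul_comm, hA _ (eA_mem_center' t) g]
  | succ k ih =>
    obtain ⟨M, hM⟩ := ih
    obtain ⟨hψs, hψZ⟩ := isArchSmooth_isZFinite_iterate hφs hφZ k
    set ψ := (lieDeriv (AutomorphyDatum.gl n K hcpt).ofArch (oneLie hcpt))^[k] φ with hψ_def
    obtain ⟨S, hSfin, hSsmooth, hSmem⟩ :=
      exists_submodule_oneParam_mem_of_isZFinite (AutomorphyDatum.gl n K hcpt).ofArch lie_one_eq_zero hψs hψZ
    haveI : FiniteDimensional ℂ S := hSfin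
    obtain ⟨C, -, hC⟩ := exists_norm_deriv_le_of_finiteDimensional S fun u hu =>
      (hSsmooth u hu).differentiable (by simp)
    refine ⟨C * M, fun g t => ?_⟩
    rw [Function.iterate_succ_apply']
    have hder : deriv (fun s : ℝ => ψ (g * eA hcpt t * eA hcpt s)) 0 =
        lieDeriv (AutomorphyDatum.gl n K hcpt).ofArch (oneLie hcpt) ψ (g * eA hcpt t) :=
      (hψs.hasDerivAt_flow_zero (AutomorphyDatum.gl n K hcpt).ofArch (oneLie hcpt) (g * eA hcpt t)).deriv
    have hbd : ∀ s ∈ Icc (-1 : ℝ) 1, ‖ψ (g * eA hcpt t * eA hcpt s)‖ ≤ M * ‖φ g‖ := fun s _ => by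
      rw [mul_assoc, ← eA_add]
      exact hM g (t + s)
    have key := hC _ (hSmem (g * eA hcpt t)) _ hbd
    rw [hder] at key
    calc _ ≤ C * (M * ‖φ g‖) := key
      _ = C * M * ‖φ g‖ := by ring

/-- **The central derivatives `1ᵏ φ` of a cusp form with `A_G`-invariant modulus are cusp forms**
(moderate growth from `norm_iterate_lieDeriv_one_apply_mul_le` at `t = 0`, then Borel–Jacquet 4.3
(ii) pointwise, `IsAutomorphicForm.lieDeriv_of_hasModerateGrowth`, and `CuspConditionGL.lieDeriv`).
[cite: BorelJacquet1979, 4.3 (ii) and 4.4] -/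
theorem IsCuspFormGL.iterate_lieDeriv_one {φ : (AdelicGroupData.gl n K).Adelic → ℂ}
    (hφ : IsCuspFormGL n K hcpt φ)
    (hA : ∀ a ∈ (AdelicGroupData.gl n K).center', ∀ g, ‖φ (a * g)‖ = ‖φ g‖) :
    ∀ k : ℕ, IsCuspFormGL n K hcpt ((lieDeriv (AutomorphyDatum.gl n K hcpt).ofArch (oneLie hcpt))^[k] φ)
  | 0 => hφ
  | k + 1 => by
    have ih := IsCuspFormGL.iterate_lieDeriv_one hφ hA k
    obtain ⟨M, hM⟩ := norm_iterate_lieDeriv_one_apply_mul_le hφ.1.archSmooth hφ.1.zFinite hA (k + 1)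
    obtain ⟨C₀, r, hC₀⟩ := hφ.1.moderateGrowth
    have hm : HasModerateGrowth (AutomorphyDatum.gl n K hcpt)
        ((lieDeriv (AutomorphyDatum.gl n K hcpt).ofArch (oneLie hcpt))^[k + 1] φ) := by
      refine ⟨max M 0 * C₀, r, fun g => ?_⟩
      have h1 := hM g 0
      rw [eA_zero, mul_one] at h1
      calc _ ≤ M * ‖φ g‖ := h1
        _ ≤ max M 0 * ‖φ g‖ := mul_le_mul_of_nonneg_right (le_max_left _ _) (norm_nonneg _)
        _ ≤ max M 0 * (C₀ * (1 ⊔ (AutomorphyDatum.gl n K hcpt).height g) ^ r) :=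
            mul_le_mul_of_nonneg_left (hC₀ g) (le_max_right _ _)
        _ = max M 0 * C₀ * (1 ⊔ (AutomorphyDatum.gl n K hcpt).height g) ^ r := by ring
    rw [Function.iterate_succ_apply'] at hm ⊢
    refine ⟨ih.1.lieDeriv_of_hasModerateGrowth isArchSmooth_lieDeriv_holds applyFree_congr_holds _ hm,
      fun k' hk' hk'n => ?_⟩
    obtain ⟨U, hU, hφU⟩ := ih.1.exists_level
    exact CuspConditionGL.lieDeriv (ih.2 k' hk' hk'n) ih.1.leftInvariant ih.1.archSmooth hU hφU _

/-- The span of the central derivatives `1ᵏ φ` (private). [cite: Borel1997, 8.6] -/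
private def dSpan (hcpt : isCompact_glFiniteIntegralLevel n K) (φ : (AdelicGroupData.gl n K).Adelic → ℂ) :
    Submodule ℂ ((AdelicGroupData.gl n K).Adelic → ℂ) :=
  Submodule.span ℂ (Set.range fun k : ℕ => (lieDeriv (AutomorphyDatum.gl n K hcpt).ofArch (oneLie hcpt))^[k] φ)

/-- The span of the `1ᵏ φ` lies in the `Z(𝔤)`-orbit span of `φ` (`1ᵏ` is a central word).
[cite: BorelJacquet1979, §1.6] -/
private theorem dSpan_le_zOrbitSpan (φ : (AdelicGroupData.gl n K).Adelic → ℂ) :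
    dSpan hcpt φ ≤ zOrbitSpan (AutomorphyDatum.gl n K hcpt).ofArch φ := by
  refine Submodule.span_le.2 ?_
  rintro _ ⟨k, rfl⟩
  refine Submodule.subset_span ⟨FreeAlgebra.ι ℝ (oneLie hcpt) ^ k,
    (isCentralWord_ι_of_forall_lie_eq_zero lie_one_eq_zero).pow k, ?_⟩
  exact (applyFree_ι_pow _ (oneLie hcpt) φ k).symm

/-- Elements of the span are smooth when `φ` is. [folklore] -/
private theorem isArchSmooth_of_mem_dSpan {φ : (AdelicGroupData.gl n K).Adelic → ℂ}
    (hφs : IsArchSmooth (AutomorphyDatum.gl n K hcpt).ofArch φ) {ψ : (AdelicGroupData.gl n K).Adelic → ℂ}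
    (hψ : ψ ∈ dSpan hcpt φ) : IsArchSmooth (AutomorphyDatum.gl n K hcpt).ofArch ψ :=
  isArchSmooth_of_mem_zOrbitSpan _ hφs (dSpan_le_zOrbitSpan φ hψ)

/-- Iterated central derivatives of a smooth function are smooth. [folklore] -/
private theorem isArchSmooth_iterate {φ : (AdelicGroupData.gl n K).Adelic → ℂ}
    (hφs : IsArchSmooth (AutomorphyDatum.gl n K hcpt).ofArch φ) :
    ∀ k : ℕ, IsArchSmooth (AutomorphyDatum.gl n K hcpt).ofArch
      ((lieDeriv (AutomorphyDatum.gl n K hcpt).ofArch (oneLie hcpt))^[k] φ)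
  | 0 => hφs
  | k + 1 => by
    rw [Function.iterate_succ_apply']
    exact (isArchSmooth_iterate hφs k).lieDeriv_gl _

/-- The span is stable under the central derivative. [folklore] -/
private theorem lieDeriv_mem_dSpan {φ : (AdelicGroupData.gl n K).Adelic → ℂ}
    (hφs : IsArchSmooth (AutomorphyDatum.gl n K hcpt).ofArch φ) {ψ : (AdelicGroupData.gl n K).Adelic → ℂ}
    (hψ : ψ ∈ dSpan hcpt φ) :
    lieDeriv (AutomorphyDatum.gl n K hcpt).ofArch (oneLie hcpt) ψ ∈ dSpan hcpt φ := by
  suffices h : IsArchSmooth (AutomorphyDatum.gl n K hcpt).ofArch ψ ∧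
      lieDeriv (AutomorphyDatum.gl n K hcpt).ofArch (oneLie hcpt) ψ ∈ dSpan hcpt φ from h.2
  induction hψ using Submodule.span_induction with
  | mem ψ h =>
    obtain ⟨k, rfl⟩ := h
    refine ⟨isArchSmooth_iterate hφs k, Submodule.subset_span ⟨k + 1, ?_⟩⟩
    exact Function.iterate_succ_apply' _ _ _
  | zero =>
    refine ⟨(archSmooth _).zero_mem, ?_⟩
    have h0 : lieDeriv (AutomorphyDatum.gl n K hcpt).ofArch (oneLie hcpt)
        (0 : (AdelicGroupData.gl n K).Adelic → ℂ) = 0 := by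
      funext g
      exact deriv_const 0 0
    rw [h0]
    exact Submodule.zero_mem _
  | add f g _ _ hf hg =>
    refine ⟨(archSmooth _).add_mem hf.1 hg.1, ?_⟩
    rw [IsArchSmooth.lieDeriv_add _ _ hf.1 hg.1]
    exact Submodule.add_mem _ hf.2 hg.2
  | smul c f _ hf =>
    refine ⟨(archSmooth _).smul_mem c hf.1, ?_⟩
    rw [lieDeriv_smul]
    exact Submodule.smul_mem _ c hf.2

/-- Every element of the span has bounded slices along `A_G` when `|φ|` is `A_G`-invariant.
[cite: Borel1997, 8.6] -/
private theorem exists_bound_slice_of_mem_dSpan {φ : (AdelicGroupData.gl n K).Adelic → ℂ}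
    (hφs : IsArchSmooth (AutomorphyDatum.gl n K hcpt).ofArch φ)
    (hφZ : IsZFinite (AutomorphyDatum.gl n K hcpt).ofArch φ)
    (hA : ∀ a ∈ (AdelicGroupData.gl n K).center', ∀ g, ‖φ (a * g)‖ = ‖φ g‖)
    {ψ : (AdelicGroupData.gl n K).Adelic → ℂ} (hψ : ψ ∈ dSpan hcpt φ) (g : (AdelicGroupData.gl n K).Adelic) :
    ∃ B : ℝ, ∀ t : ℝ, ‖ψ (g * eA hcpt t)‖ ≤ B := by
  induction hψ using Submodule.span_induction with
  | mem ψ h =>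
    obtain ⟨k, rfl⟩ := h
    obtain ⟨M, hM⟩ := norm_iterate_lieDeriv_one_apply_mul_le hφs hφZ hA k
    exact ⟨M * ‖φ g‖, fun t => hM g t⟩
  | zero => exact ⟨0, fun t => by simp⟩
  | add f f' _ _ hf hf' =>
    obtain ⟨B, hB⟩ := hf
    obtain ⟨B', hB'⟩ := hf'
    exact ⟨B + B', fun t => (norm_add_le _ _).trans (add_le_add (hB t) (hB' t))⟩
  | smul c f _ hf =>
    obtain ⟨B, hB⟩ := hf
    refine ⟨‖c‖ * B, fun t => ?_⟩
    rw [Pi.smul_apply, _root_.norm_smul]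
    exact mul_le_mul_of_nonneg_left (hB t) (norm_nonneg c)

/-- **Lemma A — bounded eigenfunctions of the central derivative have imaginary eigenvalue**: if
`1 ψ = μ ψ` with `ψ ≠ 0` smooth and all slices `t ↦ ψ(g e^t)` bounded, then `Re μ = 0`
(`ψ(g e^t) = e^{μ t} ψ(g)`, `apply_mul_expMem_eq_exp_mul_of_lieDeriv_eq_smul`). Borel–Jacquet 1979,
5.7 (unitary central character); Moeglin–Waldspurger I.3.2. [cite: BorelJacquet1979, 5.7] -/
theorem re_eq_zero_of_lieDeriv_one_eq_smul {ψ : (AdelicGroupData.gl n K).Adelic → ℂ}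
    (hψs : IsArchSmooth (AutomorphyDatum.gl n K hcpt).ofArch ψ) {μ : ℂ}
    (hD : lieDeriv (AutomorphyDatum.gl n K hcpt).ofArch (oneLie hcpt) ψ = μ • ψ)
    (hb : ∀ g, ∃ B : ℝ, ∀ t : ℝ, ‖ψ (g * eA hcpt t)‖ ≤ B) (hne : ψ ≠ 0) : μ.re = 0 := by
  obtain ⟨g, hg⟩ := Function.ne_iff.1 hne
  obtain ⟨B, hB⟩ := hb g
  have hflow : ∀ t : ℝ, ψ (g * eA hcpt t) = Complex.exp (μ * t) * ψ g := fun t =>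
    apply_mul_expMem_eq_exp_mul_of_lieDeriv_eq_smul (AutomorphyDatum.gl n K hcpt).ofArch hψs hD g t
  have hpos : 0 < ‖ψ g‖ := norm_pos_iff.2 hg
  -- `e^{Re μ · t} ≤ B / |ψ g|` for all `t`
  have hexp : ∀ t : ℝ, Real.exp (μ.re * t) ≤ B / ‖ψ g‖ := fun t => by
    rw [le_div_iff₀ hpos]
    have h := hB t
    rwa [hflow t, norm_mul, Complex.norm_exp, Complex.mul_re, Complex.ofReal_re, Complex.ofReal_im,
      mul_zero, sub_zero] at h
  by_contra hre
  -- take `t` with `Re μ · t = B / |ψ g| + 1`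
  have h := hexp ((B / ‖ψ g‖ + 1) / μ.re)
  rw [mul_div_cancel₀ _ hre] at h
  linarith [Real.add_one_le_exp (B / ‖ψ g‖ + 1)]

/-- **Lemma B — no Jordan blocks for imaginary eigenvalues**: if `Re μ = 0`, `ψ₁` is smooth with
bounded slices along `A_G`, and `ψ = 1 ψ₁ - μ ψ₁` satisfies `1 ψ = μ ψ`, then `ψ = 0`. Indeed
`G(t) = e^{-μt} ψ₁(g e^t)` has constant derivative `ψ(g)`, so `|ψ₁(g e^t)| = |ψ₁(g) + t ψ(g)|` is
unbounded unless `ψ(g) = 0`. Moeglin–Waldspurger 1995, I.3.2 (polynomial-exponential functions on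
`A_G`). [cite: MoeglinWaldspurger1995, I.3.2] -/
theorem lieDeriv_one_sub_smul_eq_zero {ψ₁ : (AdelicGroupData.gl n K).Adelic → ℂ}
    (hψ₁s : IsArchSmooth (AutomorphyDatum.gl n K hcpt).ofArch ψ₁) {μ : ℂ} (hμ : μ.re = 0)
    (hb : ∀ g, ∃ B : ℝ, ∀ t : ℝ, ‖ψ₁ (g * eA hcpt t)‖ ≤ B)
    (hψs : IsArchSmooth (AutomorphyDatum.gl n K hcpt).ofArch
      (lieDeriv (AutomorphyDatum.gl n K hcpt).ofArch (oneLie hcpt) ψ₁ - μ • ψ₁))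
    (hD : lieDeriv (AutomorphyDatum.gl n K hcpt).ofArch (oneLie hcpt)
        (lieDeriv (AutomorphyDatum.gl n K hcpt).ofArch (oneLie hcpt) ψ₁ - μ • ψ₁) =
      μ • (lieDeriv (AutomorphyDatum.gl n K hcpt).ofArch (oneLie hcpt) ψ₁ - μ • ψ₁)) :
    lieDeriv (AutomorphyDatum.gl n K hcpt).ofArch (oneLie hcpt) ψ₁ - μ • ψ₁ = 0 := by
  set ψ := lieDeriv (AutomorphyDatum.gl n K hcpt).ofArch (oneLie hcpt) ψ₁ - μ • ψ₁ with hψ_def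
  funext g
  by_contra hg
  obtain ⟨B, hB⟩ := hb g
  have hflow : ∀ t : ℝ, ψ (g * eA hcpt t) = Complex.exp (μ * t) * ψ g := fun t =>
    apply_mul_expMem_eq_exp_mul_of_lieDeriv_eq_smul (AutomorphyDatum.gl n K hcpt).ofArch hψs hD g t
  -- `G(t) = e^{-μ t} ψ₁(g e^t)` has derivative `ψ(g)`
  set G : ℝ → ℂ := fun t => Complex.exp (-(μ * t)) * ψ₁ (g * eA hcpt t) with hG_def
  have hGd : ∀ t : ℝ, HasDerivAt G (ψ g) t := by
    intro t
    have h1 : HasDerivAt (fun s : ℝ => ψ₁ (g * eA hcpt s))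
        (lieDeriv (AutomorphyDatum.gl n K hcpt).ofArch (oneLie hcpt) ψ₁ (g * eA hcpt t)) t :=
      hψ₁s.hasDerivAt_flow (AutomorphyDatum.gl n K hcpt).ofArch (oneLie hcpt) g t
    have h2 : HasDerivAt (fun s : ℝ => Complex.exp (-(μ * s))) (Complex.exp (-(μ * t)) * (-μ)) t := by
      have h3 : HasDerivAt (fun s : ℝ => -(μ * (s : ℂ))) (-μ) t := by
        have := ((hasDerivAt_id (t : ℂ)).const_mul μ).neg.comp_ofReal
        simpa using this
      exact h3.cexp
    have h4 := h2.mul h1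
    have hval : Complex.exp (-(μ * t)) * (-μ) * ψ₁ (g * eA hcpt t) +
        Complex.exp (-(μ * t)) * lieDeriv (AutomorphyDatum.gl n K hcpt).ofArch (oneLie hcpt) ψ₁ (g * eA hcpt t) =
        ψ g := by
      have e1 : Complex.exp (-(μ * t)) * (-μ) * ψ₁ (g * eA hcpt t) +
          Complex.exp (-(μ * t)) * lieDeriv (AutomorphyDatum.gl n K hcpt).ofArch (oneLie hcpt) ψ₁ (g * eA hcpt t) =
          Complex.exp (-(μ * t)) * ψ (g * eA hcpt t) := by
        rw [hψ_def, Pi.sub_apply, Pi.smul_apply, smul_eq_mul]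
        ring
      rw [e1, hflow t, ← mul_assoc, ← Complex.exp_add, neg_add_cancel, Complex.exp_zero, one_mul]
    rw [hval] at h4
    exact h4
  -- hence `G(t) = G(0) + t ψ(g)`
  have hGlin : ∀ t : ℝ, G t = G 0 + t * ψ g := by
    have hdiff : Differentiable ℝ fun t : ℝ => G t - t * ψ g := fun t =>
      ((hGd t).sub ((hasDerivAt_id t).ofReal_comp.mul_const (ψ g))).differentiableAt
    have hzero : ∀ t : ℝ, deriv (fun t : ℝ => G t - t * ψ g) t = 0 := fun t => by
      have h := ((hGd t).sub ((hasDerivAt_id t).ofReal_comp.mul_const (ψ g))).deriv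
      simp only [Pi.sub_def, id_eq, Complex.ofReal_one, one_mul, sub_self] at h
      exact h
    intro t
    have h := is_const_of_deriv_eq_zero hdiff hzero t 0
    simp only [Complex.ofReal_zero, zero_mul, sub_zero] at h
    rw [← h]
    ring
  have hG0 : G 0 = ψ₁ g := by
    rw [hG_def]
    dsimp only
    rw [Complex.ofReal_zero, mul_zero, neg_zero, Complex.exp_zero, one_mul, eA_zero, mul_one]
  -- `|ψ₁(g e^t)| = |G t|` since `Re μ = 0`
  have hnorm : ∀ t : ℝ, ‖ψ₁ (g * eA hcpt t)‖ = ‖ψ₁ g + t * ψ g‖ := fun t => by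
    have h1 : ψ₁ (g * eA hcpt t) = Complex.exp (μ * t) * G t := by
      rw [hG_def]
      dsimp only
      rw [← mul_assoc, ← Complex.exp_add, add_neg_cancel, Complex.exp_zero, one_mul]
    rw [h1, norm_mul, Complex.norm_exp, Complex.mul_re, hμ, Complex.ofReal_re, Complex.ofReal_im,
      zero_mul, mul_zero, sub_zero, Real.exp_zero, one_mul, hGlin t, hG0]
  -- contradiction for large `t`
  have hpos : 0 < ‖ψ g‖ := norm_pos_iff.2 hg
  set t₀ : ℝ := (B + ‖ψ₁ g‖ + 1) / ‖ψ g‖ with ht₀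
  have hB0 : 0 ≤ B := (norm_nonneg _).trans (hB 0)
  have ht₀pos : 0 ≤ t₀ := by
    rw [ht₀]
    exact div_nonneg (by linarith [norm_nonneg (ψ₁ g)]) hpos.le
  have h1 := hB t₀
  rw [hnorm t₀] at h1
  have h2 : ‖(t₀ : ℂ) * ψ g‖ ≤ ‖ψ₁ g + t₀ * ψ g‖ + ‖ψ₁ g‖ := by
    have := norm_sub_le (ψ₁ g + t₀ * ψ g) (ψ₁ g)
    rw [add_sub_cancel_left] at this
    exact this
  rw [norm_mul, Complex.norm_real, Real.norm_of_nonneg ht₀pos] at h2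
  have h3 : t₀ * ‖ψ g‖ = B + ‖ψ₁ g‖ + 1 := by rw [ht₀, div_mul_cancel₀ _ hpos.ne']
  linarith


/-- `1ᵏ φ` lies in the span of cusp forms when `φ` is a cusp form with `A_G`-invariant modulus. [folklore] -/
private theorem dSpan_le_cuspFormsGL {φ : (AdelicGroupData.gl n K).Adelic → ℂ}
    (hφ : IsCuspFormGL n K hcpt φ)
    (hA : ∀ a ∈ (AdelicGroupData.gl n K).center', ∀ g, ‖φ (a * g)‖ = ‖φ g‖) :
    dSpan hcpt φ ≤ cuspFormsGL n K hcpt := by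
  refine Submodule.span_le.2 ?_
  rintro _ ⟨k, rfl⟩
  exact (hφ.iterate_lieDeriv_one hA k).mem_cuspFormsGL

set_option maxHeartbeats 1600000 in
/-- **Cusp forms on `GL_n(𝔸_K)`, `n ≥ 1`, whose modulus is invariant under `A_G` are bounded**
(Borel–Jacquet 1979, 4.4 with 5.7; Moeglin–Waldspurger 1995, I.2.18 with I.3.2). On the
finite-dimensional span `W` of the central derivatives `1ᵏ φ` (inside the `Z(𝔤)`-orbit span of
`φ`; its elements are cusp forms with bounded slices along `A_G`), decompose `φ = ∑_μ φ_μ` into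
generalised eigenvectors of the central derivative `1` (`Module.End.iSup_maxGenEigenspace_eq_top`);
by Lemmas A and B (`re_eq_zero_of_lieDeriv_one_eq_smul`, `lieDeriv_one_sub_smul_eq_zero`) each
`φ_μ ≠ 0` is an eigenfunction, `φ_μ(a g) = a^μ φ_μ(g)` on `A_G` with `Re μ = 0`; the twist
`|det|^{-μ/n[K:ℚ]} φ_μ` is an `A_G`-INVARIANT cusp form (`IsCuspFormGL.mulChar_detTwist_of_cpow`,
`mulChar_detTwist_apply_posRealScalar_mul_of_cpow`), bounded by Harish-Chandra's theorem
`IsCuspFormGL.bounded_of_center'`, and `|φ_μ| = ||det|^{-μ/n[K:ℚ]} φ_μ|`. [cite: BorelJacquet1979, 4.4 and 5.7] -/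
theorem IsCuspFormGL.bounded_of_norm_center' [NeZero n] {φ : (AdelicGroupData.gl n K).Adelic → ℂ}
    (hφ : IsCuspFormGL n K hcpt φ)
    (hA : ∀ a ∈ (AdelicGroupData.gl n K).center', ∀ g, ‖φ (a * g)‖ = ‖φ g‖) :
    ∃ C : ℝ, ∀ g : (AdelicGroupData.gl n K).Adelic, ‖φ g‖ ≤ C := by
  have hφs := hφ.1.archSmooth
  -- the finite-dimensional span `W` of the central derivatives
  set W := dSpan hcpt φ with hW_def
  haveI : FiniteDimensional ℂ (zOrbitSpan (AutomorphyDatum.gl n K hcpt).ofArch φ) := hφ.1.zFinite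
  haveI : FiniteDimensional ℂ W := Submodule.finiteDimensional_of_le (dSpan_le_zOrbitSpan φ)
  have hWsm : ∀ ψ ∈ W, IsArchSmooth (AutomorphyDatum.gl n K hcpt).ofArch ψ := fun ψ hψ =>
    isArchSmooth_of_mem_dSpan hφs hψ
  have hWb : ∀ ψ ∈ W, ∀ g, ∃ B : ℝ, ∀ t : ℝ, ‖ψ (g * eA hcpt t)‖ ≤ B := fun ψ hψ g =>
    exists_bound_slice_of_mem_dSpan hφs hφ.1.zFinite hA hψ g
  have hWcusp : W ≤ cuspFormsGL n K hcpt := dSpan_le_cuspFormsGL hφ hA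
  -- the central derivative as an endomorphism of `W`
  let T : Module.End ℂ W :=
    { toFun := fun ψ => ⟨lieDeriv (AutomorphyDatum.gl n K hcpt).ofArch (oneLie hcpt) ψ,
        lieDeriv_mem_dSpan hφs ψ.2⟩
      map_add' := fun ψ ψ' => Subtype.ext (IsArchSmooth.lieDeriv_add _ _ (hWsm _ ψ.2) (hWsm _ ψ'.2))
      map_smul' := fun c ψ => Subtype.ext (lieDeriv_smul _ c _) }
  have hT : ∀ ψ : W, ((T ψ : W) : (AdelicGroupData.gl n K).Adelic → ℂ) =
      lieDeriv (AutomorphyDatum.gl n K hcpt).ofArch (oneLie hcpt) ψ := fun _ => rfl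
  have hN : ∀ (μ : ℂ) (ψ : W), (((T - μ • (1 : Module.End ℂ W)) ψ : W) : (AdelicGroupData.gl n K).Adelic → ℂ) =
      lieDeriv (AutomorphyDatum.gl n K hcpt).ofArch (oneLie hcpt) ψ - μ • (ψ : (AdelicGroupData.gl n K).Adelic → ℂ) :=
    fun μ ψ => rfl
  -- Lemmas A and B inside `W`
  have hAW : ∀ (μ : ℂ) (ψ : W), (T - μ • (1 : Module.End ℂ W)) ψ = 0 → ψ ≠ 0 → μ.re = 0 := by
    intro μ ψ h0 hne
    refine re_eq_zero_of_lieDeriv_one_eq_smul (hWsm _ ψ.2) ?_ (hWb _ ψ.2) ?_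
    · have h := congrArg (fun u : W => (u : (AdelicGroupData.gl n K).Adelic → ℂ)) h0
      simp only [hN, Submodule.coe_zero] at h
      exact sub_eq_zero.1 h
    · exact fun h => hne (Subtype.ext h)
  have hBW : ∀ (μ : ℂ) (ψ : W), μ.re = 0 →
      (T - μ • (1 : Module.End ℂ W)) ((T - μ • (1 : Module.End ℂ W)) ψ) = 0 →
      (T - μ • (1 : Module.End ℂ W)) ψ = 0 := by
    intro μ ψ hμ h0
    apply Subtype.ext
    rw [hN, Submodule.coe_zero]
    refine lieDeriv_one_sub_smul_eq_zero (hWsm _ ψ.2) hμ (hWb _ ψ.2) ?_ ?_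
    · rw [← hN]; exact hWsm _ ((T - μ • 1) ψ).2
    · have h := congrArg (fun u : W => (u : (AdelicGroupData.gl n K).Adelic → ℂ)) h0
      simp only [hN, Submodule.coe_zero] at h
      rw [← hN] at h ⊢
      exact sub_eq_zero.1 h
  -- no Jordan blocks: `(T - μ)^(k+1) ψ = 0 → (T - μ) ψ = 0`
  have hind : ∀ (μ : ℂ) (k : ℕ) (ψ : W), ((T - μ • (1 : Module.End ℂ W)) ^ (k + 1)) ψ = 0 →
      (T - μ • (1 : Module.End ℂ W)) ψ = 0 := by
    intro μ k
    induction k with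
    | zero => intro ψ h; rwa [zero_add, pow_one] at h
    | succ k ih =>
      intro ψ h
      rw [pow_succ, Module.End.mul_apply] at h
      have h1 := ih _ h
      by_cases h2 : (T - μ • (1 : Module.End ℂ W)) ψ = 0
      · exact h2
      · exact hBW μ ψ (hAW μ _ h1 h2) h1
  -- decompose `φ` into generalised eigenvectors
  set φW : W := ⟨φ, Submodule.subset_span ⟨0, rfl⟩⟩ with hφW
  have hmem : φW ∈ ⨆ μ : ℂ, T.maxGenEigenspace μ := by
    rw [Module.End.iSup_maxGenEigenspace_eq_top]
    exact Submodule.mem_top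
  obtain ⟨f, hf, hsum⟩ := (Submodule.mem_iSup_iff_exists_finsupp _ φW).1 hmem
  -- each component is an eigenfunction with imaginary eigenvalue, or zero
  have heig : ∀ μ : ℂ, (T - μ • (1 : Module.End ℂ W)) (f μ) = 0 := by
    intro μ
    obtain ⟨k, hk⟩ := (Module.End.mem_maxGenEigenspace _ _ _).1 (hf μ)
    cases k with
    | zero =>
      rw [pow_zero, Module.End.one_apply] at hk
      rw [hk, map_zero]
    | succ k => exact hind μ k _ hk
  -- a bound for each component
  have hcomp : ∀ μ : ℂ, ∃ Cμ : ℝ, ∀ g, ‖((f μ : W) : (AdelicGroupData.gl n K).Adelic → ℂ) g‖ ≤ Cμ := by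
    intro μ
    by_cases hz : f μ = 0
    · exact ⟨0, fun g => by rw [hz, Submodule.coe_zero, Pi.zero_apply, norm_zero]⟩
    have hre : μ.re = 0 := hAW μ _ (heig μ) hz
    set ψ : (AdelicGroupData.gl n K).Adelic → ℂ := ((f μ : W) : (AdelicGroupData.gl n K).Adelic → ℂ) with hψ_def
    have hψs : IsArchSmooth (AutomorphyDatum.gl n K hcpt).ofArch ψ := hWsm _ (f μ).2
    have hD : lieDeriv (AutomorphyDatum.gl n K hcpt).ofArch (oneLie hcpt) ψ = μ • ψ := by
      have h := congrArg (fun u : W => (u : (AdelicGroupData.gl n K).Adelic → ℂ)) (heig μ)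
      simp only [hN, Submodule.coe_zero] at h
      exact sub_eq_zero.1 h
    have hψc : IsCuspFormGL n K hcpt ψ := isCuspFormGL_of_mem_cuspFormsGL' (hWcusp (f μ).2)
    -- the character of `A_G` on `ψ`
    have hflow : ∀ (t : ℝ) (g : (AdelicGroupData.gl n K).Adelic),
        ψ (g * eA hcpt t) = Complex.exp (μ * t) * ψ g := fun t g =>
      apply_mul_expMem_eq_exp_mul_of_lieDeriv_eq_smul (AutomorphyDatum.gl n K hcpt).ofArch hψs hD g t
    have hchar : ∀ (τ : ℝ≥0ˣ) (g : (AdelicGroupData.gl n K).Adelic),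
        ψ ((show (AdelicGroupData.gl n K).Adelic from posRealScalar n K τ) * g) = (((τ : ℝ≥0) : ℝ) : ℂ) ^ μ * ψ g := by
      intro τ g
      have hτ : (0 : ℝ) < ((τ : ℝ≥0) : ℝ) := NNReal.coe_pos.2 (pos_iff_ne_zero.2 τ.ne_zero)
      change ψ ((show (AdelicGroupData.gl n K).Adelic from posRealScalar n K τ) * g) = _
      rw [show (show (AdelicGroupData.gl n K).Adelic from posRealScalar n K τ) = eA hcpt (Real.log ((τ : ℝ≥0) : ℝ))
        from posRealScalar_eq_eA (hcpt := hcpt) τ, eA_mul_comm, hflow]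
      congr 1
      rw [Complex.cpow_def_of_ne_zero (Complex.ofReal_ne_zero.2 hτ.ne'), ← Complex.ofReal_log hτ.le, mul_comm]
    -- the twist `|det|^{-μ / n[K:ℚ]} ψ`
    set N : ℕ := n * Module.finrank ℚ K with hN_def
    have hN0 : (N : ℂ) ≠ 0 := by
      rw [hN_def, Nat.cast_ne_zero]
      exact Nat.mul_ne_zero (NeZero.ne n) Module.finrank_pos.ne'
    set s : ℂ := -μ / N with hs_def
    have hs : s * (n * Module.finrank ℚ K : ℕ) = -μ := by
      rw [hs_def, ← hN_def, div_mul_cancel₀ _ hN0]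
    have hsre : s.re = 0 := by
      rw [hs_def, Complex.div_natCast_re, Complex.neg_re, hre, neg_zero, zero_div]
    obtain ⟨χ, hχ⟩ := exists_heckeCharacter_ideleNorm_cpow (K := K) s
    have htw : IsCuspFormGL n K hcpt (mulChar (detTwist n χ) ψ) := hψc.mulChar_detTwist_of_cpow hχ
    have hinv : ∀ z ∈ (AdelicGroupData.gl n K).center', ∀ g,
        mulChar (detTwist n χ) ψ (z * g) = mulChar (detTwist n χ) ψ g := by
      rintro _ ⟨τ, rfl⟩ g
      exact mulChar_detTwist_apply_posRealScalar_mul_of_cpow hχ hs hchar τ g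
    obtain ⟨Cμ, hCμ⟩ := htw.bounded_of_center' hinv
    refine ⟨Cμ, fun g => ?_⟩
    have h1 := hCμ g
    rw [mulChar_apply, norm_mul, norm_detTwist_of_cpow hχ, hsre, Real.rpow_zero, one_mul] at h1
    exact h1
  choose Cμ hCμ using hcomp
  refine ⟨∑ μ ∈ f.support, Cμ μ, fun g => ?_⟩
  have hφsum : φ = ∑ μ ∈ f.support, ((f μ : W) : (AdelicGroupData.gl n K).Adelic → ℂ) := by
    have h := congrArg (fun u : W => (u : (AdelicGroupData.gl n K).Adelic → ℂ)) hsum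
    simp only [Finsupp.sum, Submodule.coe_sum] at h
    exact h.symm
  calc ‖φ g‖ = ‖∑ μ ∈ f.support, ((f μ : W) : (AdelicGroupData.gl n K).Adelic → ℂ) g‖ := by
        conv_lhs => rw [hφsum]
        rw [Finset.sum_apply]
    _ ≤ ∑ μ ∈ f.support, ‖((f μ : W) : (AdelicGroupData.gl n K).Adelic → ℂ) g‖ := norm_sum_le _ _
    _ ≤ ∑ μ ∈ f.support, Cμ μ := Finset.sum_le_sum fun μ _ => hCμ μ g

end CenterODE

section Discharge

/-- **Discharge of `cuspForm_bounded` (Borel–Jacquet 1979, 4.4 and 5.7): a cusp form on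
`GL_n(𝔸_K)` whose modulus is invariant under the centre `Z(𝔸_K)` is bounded.** For `n = 0` the
group is trivial; for `n ≥ 1`, `A_G ≤ Z(𝔸_K)` (`center'_le`) and
`IsCuspFormGL.bounded_of_norm_center'`. [cite: BorelJacquet1979, 4.4 and 5.7] -/
theorem cuspForm_bounded_holds {hcpt : isCompact_glFiniteIntegralLevel n K} : cuspForm_bounded hcpt := by
  intro φ hφ hZ
  rcases Nat.eq_zero_or_pos n with hn | hn
  · subst hn
    refine ⟨‖φ 1‖, fun g => ?_⟩
    rw [Subsingleton.elim (α := GL (Fin 0) (AdeleRing (𝓞 K) K)) g 1]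
    rfl
  · haveI : NeZero n := ⟨hn.ne'⟩
    exact hφ.bounded_of_norm_center' fun a ha g => hZ a ((AdelicGroupData.gl n K).center'_le ha) g

end Discharge

end Literature.NumberTheory.Automorphic
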